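import Mathlib

/-!
# SchurPairExpansion — the exact pair expansion of the interior-point Schur operator in a joint basis
(hubbard-algo crew (5), D-0042 R2(e); companion of `CentralPathExponentDichotomy.lean` and of the M-class
preconditioner study kit j263631 of hubbard-algo-p1 g7 (`HOME/hubbard-algo-p1/kit/pairstudy_M/`); pure matrix
algebra over ℝ — NO number and NO bound on any Hubbard quantity lives here)

HONEST FRAMING: first certified bounds; not a superconductivity verdict. In the matrix-free interior-point kernel of
the cell (krysdp / symsdp, HKM direction) the Schur operator of one semidefinite block acts on the free moment
coordinates through `M_ij = ½ (tr (F_i X F_j S⁻¹) + tr (F_j X F_i S⁻¹))`, `S ≻ 0` the moment-side block, `X` the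
multiplier block. The kit study expands `M` EXACTLY as a sum over eigen-direction PAIRS `(a, b)` of rank-one terms
with weights `(λ_a + λ_b)/2`, using a joint basis `N` with `Nᵀ S N = 1` and `X = N Λ Nᵀ` (`Λ = diagonal λ`), and then
asks which pairs a preconditioner must keep. This file books the identity that makes the expansion exact:

* `inv_eq_mul_transpose_of_congruence` — `Nᵀ S N = 1` (square matrices) forces `S⁻¹ = N Nᵀ`;
* `trace_hkm_joint_basis` — `tr (A X B (N Nᵀ)) = Σ_a Σ_b (NᵀAN)_ab · λ_b · (NᵀBN)_ba` for `X = N Λ Nᵀ`;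
* `trace_hkm_eq_pair_sum` — the same with `S⁻¹` in place of `N Nᵀ` under `Nᵀ S N = 1`;
* `trace_hkm_eq_symmetric_pair_sum` — for symmetric `A`, `B` the entry equals
  `Σ_a Σ_b ((λ_a + λ_b)/2) · (NᵀAN)_ab · (NᵀBN)_ab` (and `trace_hkm_symm`: it is symmetric in `(A, B)`), i.e. `M = F · diagonal φ · Fᵀ` with `φ_ab = (λ_a + λ_b)/2` and
  `F_i,ab = (NᵀF_iN)_ab` (the kit folds the unordered pairs `a ≤ b` with the usual `√2` weights — bookkeeping not
  repeated here).
What is NOT claimed: existence of the joint basis (it is the Cholesky/eigen construction `N = U L⁻ᵀ Q` of the kernel,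
verified numerically to 1e-14 in kit j263424/j263631), any statement about preconditioner quality, or any bound.
-/

namespace Summit.Ventures.CertifiedManyBodySolver.HubbardAlg.SchurPairExpansion

open Matrix BigOperators

variable {n : Type*} [Fintype n] [DecidableEq n]

/-- A congruence to the identity inverts: `Nᵀ S N = 1` (all square) gives `S⁻¹ = N Nᵀ`. -/
theorem inv_eq_mul_transpose_of_congruence {S N : Matrix n n ℝ} (h : Nᵀ * S * N = 1) :
    S⁻¹ = N * Nᵀ := by
  -- `(Nᵀ S) N = 1 ⇒ N (Nᵀ S) = 1 ⇒ (N Nᵀ) S = 1 ⇒ S (N Nᵀ) = 1`.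
  have h1 : N * (Nᵀ * S) = 1 := mul_eq_one_comm.mp h
  have h2 : (N * Nᵀ) * S = 1 := by rw [Matrix.mul_assoc]; exact h1
  have h3 : S * (N * Nᵀ) = 1 := mul_eq_one_comm.mp h2
  exact Matrix.inv_eq_right_inv h3

/-- The trace identity in a joint basis: with `X = N Λ Nᵀ`,
`tr (A X B (N Nᵀ)) = Σ_a Σ_b (NᵀAN)_ab · λ_b · (NᵀBN)_ba`. -/
theorem trace_hkm_joint_basis (A B N : Matrix n n ℝ) (lam : n → ℝ) :
    Matrix.trace (A * (N * Matrix.diagonal lam * Nᵀ) * B * (N * Nᵀ)) =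
      ∑ a, ∑ b, (Nᵀ * A * N) a b * lam b * (Nᵀ * B * N) b a := by
  have hcyc : Matrix.trace (A * (N * Matrix.diagonal lam * Nᵀ) * B * (N * Nᵀ)) =
      Matrix.trace ((Nᵀ * A * N) * Matrix.diagonal lam * (Nᵀ * B * N)) := by
    have e1 : A * (N * Matrix.diagonal lam * Nᵀ) * B * (N * Nᵀ) =
        (A * N * Matrix.diagonal lam * (Nᵀ * B * N)) * Nᵀ := by
      simp only [Matrix.mul_assoc]
    rw [e1, Matrix.trace_mul_comm]
    congr 1
    simp only [Matrix.mul_assoc]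
  rw [hcyc]
  generalize Nᵀ * A * N = P
  generalize Nᵀ * B * N = Q
  have hdiag : ∀ a, (P * Matrix.diagonal lam * Q) a a = ∑ b, P a b * lam b * Q b a := fun a => by
    rw [Matrix.mul_apply]
    exact Finset.sum_congr rfl fun b _ => by rw [Matrix.mul_diagonal]
  simp only [Matrix.trace, Matrix.diag_apply, hdiag]

/-- The same identity with `S⁻¹`, under the joint-basis hypothesis `Nᵀ S N = 1`. -/
theorem trace_hkm_eq_pair_sum {S N X : Matrix n n ℝ} {lam : n → ℝ} (hS : Nᵀ * S * N = 1)
    (hX : X = N * Matrix.diagonal lam * Nᵀ) (A B : Matrix n n ℝ) :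
    Matrix.trace (A * X * B * S⁻¹) = ∑ a, ∑ b, (Nᵀ * A * N) a b * lam b * (Nᵀ * B * N) b a := by
  rw [inv_eq_mul_transpose_of_congruence hS, hX]
  exact trace_hkm_joint_basis A B N lam

omit [DecidableEq n] in
/-- Conjugation preserves symmetry: `(Nᵀ A N)ᵀ = Nᵀ A N` for symmetric `A`. -/
theorem conj_transpose_symm {A N : Matrix n n ℝ} (hA : Aᵀ = A) : (Nᵀ * A * N)ᵀ = Nᵀ * A * N := by
  rw [Matrix.transpose_mul, Matrix.transpose_mul, Matrix.transpose_transpose, hA, Matrix.mul_assoc]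

/-- **Pair expansion of the Schur entry.** For symmetric `A`, `B`, a joint basis `Nᵀ S N = 1` and
`X = N Λ Nᵀ`: `tr (A X B S⁻¹) = Σ_a Σ_b ((λ_a + λ_b)/2) · (NᵀAN)_ab · (NᵀBN)_ab` — every unordered eigen-direction
pair `{a, b}` contributes a rank-one term with weight `φ_ab = (λ_a + λ_b)/2` (the kit's `M = F · diagonal φ · Fᵀ`).
(For symmetric data the two orderings `tr (A X B S⁻¹)` and `tr (B X A S⁻¹)` coincide — `trace_hkm_symm` — so no
explicit symmetrisation of the entry is needed.) -/
theorem trace_hkm_eq_symmetric_pair_sum {S N X A B : Matrix n n ℝ} {lam : n → ℝ}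
    (hS : Nᵀ * S * N = 1) (hX : X = N * Matrix.diagonal lam * Nᵀ) (hA : Aᵀ = A) (hB : Bᵀ = B) :
    Matrix.trace (A * X * B * S⁻¹) =
      ∑ a, ∑ b, (lam a + lam b) / 2 * ((Nᵀ * A * N) a b * (Nᵀ * B * N) a b) := by
  rw [trace_hkm_eq_pair_sum hS hX A B]
  have hA' := conj_transpose_symm (N := N) hA
  have hB' := conj_transpose_symm (N := N) hB
  set EA := Nᵀ * A * N with hEA_def
  set EB := Nᵀ * B * N with hEB_def
  have hEAs : ∀ a b, EA b a = EA a b := fun a b => by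
    have h := congrFun (congrFun hA' a) b
    rwa [Matrix.transpose_apply] at h
  have hEBs : ∀ a b, EB b a = EB a b := fun a b => by
    have h := congrFun (congrFun hB' a) b
    rwa [Matrix.transpose_apply] at h
  -- U: use the symmetry of `EB` in the second factor
  have hU : ∑ a, ∑ b, EA a b * lam b * EB b a = ∑ a, ∑ b, EA a b * lam b * EB a b := by
    refine Finset.sum_congr rfl fun a _ => Finset.sum_congr rfl fun b _ => ?_
    rw [hEBs a b]
  -- T': the same double sum with `lam a` in place of `lam b` (rename the indices, using both symmetries)
  have hT : ∑ a, ∑ b, EA a b * lam b * EB a b = ∑ a, ∑ b, EA a b * lam a * EB a b := by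
    calc ∑ a, ∑ b, EA a b * lam b * EB a b = ∑ a, ∑ b, EA b a * lam b * EB b a := by
          refine Finset.sum_congr rfl fun a _ => Finset.sum_congr rfl fun b _ => ?_
          rw [hEAs a b, hEBs a b]
      _ = ∑ b, ∑ a, EA b a * lam b * EB b a := Finset.sum_comm
      _ = ∑ a, ∑ b, EA a b * lam a * EB a b := rfl
  have key : ∀ a b, (lam a + lam b) / 2 * (EA a b * EB a b) =
      (EA a b * lam a * EB a b) / 2 + (EA a b * lam b * EB a b) / 2 := fun a b => by ring
  rw [hU]
  simp_rw [key, Finset.sum_add_distrib, ← Finset.sum_div]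
  rw [← hT]
  ring

/-- For symmetric data the Schur entry is already symmetric in `(A, B)`: `tr (A X B S⁻¹) = tr (B X A S⁻¹)`. -/
theorem trace_hkm_symm {S N X A B : Matrix n n ℝ} {lam : n → ℝ}
    (hS : Nᵀ * S * N = 1) (hX : X = N * Matrix.diagonal lam * Nᵀ) (hA : Aᵀ = A) (hB : Bᵀ = B) :
    Matrix.trace (A * X * B * S⁻¹) = Matrix.trace (B * X * A * S⁻¹) := by
  rw [trace_hkm_eq_symmetric_pair_sum hS hX hA hB, trace_hkm_eq_symmetric_pair_sum hS hX hB hA]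
  refine Finset.sum_congr rfl fun a _ => Finset.sum_congr rfl fun b _ => ?_
  ring

end Summit.Ventures.CertifiedManyBodySolver.HubbardAlg.SchurPairExpansion
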